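import Summits.BirchSwinnertonDyer.BirchSwinnertonDyer.Theorems.GenusKolyvaginAtTwoEquivariantKolyvaginExactAtTwoSelmerDescentRamified
import Literature.NumberTheory.GaloisRepresentations.TameInertiaGlobalCyclic
import Literature.NumberTheory.EllipticCurves.TateModuleUnipotentInertiaProofs
import Literature.NumberTheory.EllipticCurves.IsogenyMulProofs
import HarnessLib

/-!
# Route `GenusKolyvaginAtTwo`, crux U_T `ShaCardDvdPowAtTwoRT` (stmt-BirchSwinnertonDyer-23658) — THE GENUS LAYER OF THE
# DESCENT AT 2: along a quadratic extension RAMIFIED at a good odd place, EVERY class of `H¹(F, E[2])` becomes Selmer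
# upstairs (Abhyankar's lemma at level 2), so `res⁻¹(Sel₂(E_L/L))` carries NO local condition at the ramified primes

Seat `bsd-line-gk2-p3` g26 (PROVER seat 3/3, cell `bsd-f1-sign2`), `--supports stmt-BirchSwinnertonDyer-23658` (helper; closes
nothing).  THEOREMS ONLY (no definition, no named fact, no `sorry`).  BSD is NOT proved by any of this; neither is U_T nor any stub.

WHY (this seat's U_T memo `Cruxes/ShaCardDvdPowAtTwoRT/Lines/norm-tate-accounting-gk2p3g26.md` §2–§3).  The τ-invariant part of
`Sel₂(E_K/K)` (`K` the Heegner field) is `res(S_ℚ)`, `S_ℚ = res⁻¹(Sel₂(E_K/K))`; this lineage transferred the Selmer condition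
`K → ℚ` exactly at split / unramified places (`…SelmerDescentUnramified/Quadratic/Inert`) and, at a RAMIFIED prime `q ∣ d_K`, away
from `D_𝔓`-fixed `2`-torsion (`…SelmerDescentRamified`, the 3-cycle primes) or up to one bit (`…ROneBitDescent`).  This file proves
the converse containment that makes `S_ℚ` the `ℚ`-Selmer group RELAXED at the ramified primes: at a good place `v ∤ 2` of `F`
above which `L/F` is ramified "quadratically" (witnessed by a continuous character `χ` of `Γ_F` of exponent `2`, trivial on
`res Γ_L`, non-trivial on the inertia group `I_𝔓`), the restriction to `L` of ANY class `x ∈ H¹(F, E[2])` satisfies the Selmer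
condition at the place `w ∣ v` — Abhyankar's lemma for `2`-torsion coefficients: a cocycle is a homomorphism on `I_𝔓` (good
reduction, `v ∤ 2`), the tame inertia is pro-cyclic mod the (pro-`p`, `p` odd) wild group, so `φ|_{I_𝔓}` and `χ|_{I_𝔓}` are powers of
ONE order-`2` character of a tame generator `s`; `χ(s) ≠ 1` and `χ(res I_𝔔) = 1` force `res I_𝔔 ⊆ ⟨s²⟩·(wild)`, where `φ` vanishes.
Counting consequence (memo §3, Kramer 1981): `dim Sel₂(E_K/K)^τ = dim Sel₂^{str D}(E/ℚ) + Σ_{q ∣ d_K} dim E(ℚ_q)[2]`.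

* §1 `exists_apply_inertia_eq_apply_torsion_mul_zpow` — for a number field `K`, `𝔓 ∣ v`, and a continuous `f : Γ_K → H` to a discrete
  group: some `s ∈ I_𝔓` has `f g = f w · (f s)^k` for every `g ∈ I_𝔓`, with `w ∈ I_𝔓` and `(f w)^{p^t} = 1`, `p` the residue
  characteristic (the tree's `exists_apply_inertia_eq_apply_wild_mul_zpow` with the wild factor read through
  `isPGroup_ramificationSubgroup_one_of_mem_primesAbove`: `G_1` is a `p`-group).
* §2 **`resTorsion_two_mem_selmerLocalKer_of_ramifiedCharacter`** — the statement above (any number fields `L/F`, any elliptic `E/F`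
  good at `v ∤ 2`, `w ∣ v`, `𝔔 ∣ w`, `𝔓 = 𝔔 ∩ F̄`).

References: [SerreLocalFields1979] IV §2 Cor. 1 & 3 of Prop. 7 (tame quotient cyclic, `G_1` a `p`-group); [NeukirchANT1999] II (7.13),
V (3.3); [Kramer1981] Prop. 3, §4 (13) («if `S(F) = 0` then `dim S(K) = Σ i_v`»); [GrossLMS1991] §7 (7.1)/(7.4); [McCallumLMS1991] §4 Lemma 4.3.
-/

set_option autoImplicit false
-- `Summit.<P>.<Sub>` repeats `BirchSwinnertonDyer` by the tree's layout convention (D-0017)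
set_option linter.dupNamespace false

noncomputable section

open scoped Classical Pointwise

namespace Summit.BirchSwinnertonDyer.BirchSwinnertonDyer.Theorems.GenusExact.SelmerDescent

open WeierstrassCurve NumberField IsDedekindDomain Field
open Literature.NumberTheory.EllipticCurves Literature.NumberTheory.GaloisRepresentations

/-! ## §1 Tame inertia: one generator, up to a wild factor of `p`-power order -/

section Tame

variable {K : Type} [Field K] [NumberField K]

/-- **`I_𝔓 = (wild) · ⟨s⟩` in every discrete image, with the wild factor of `p`-power order.**  For a number field `K`, a
prime `𝔓 ∣ v` of `\bar ℤ_K` and a continuous homomorphism `f : Γ_K → H` to a discrete group there is `s ∈ I_𝔓` such that every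
`g ∈ I_𝔓` satisfies `f g = f w · (f s)^k` for some `k : ℤ` and some `w ∈ I_𝔓` with `(f w)^(p^t) = 1` for some `t`, `p` the residue
characteristic of `v` (finite level: `G_0(𝔮) = G_1(𝔮)·⟨s̄⟩`, Serre IV §2 Cor. 1, and `G_1(𝔮)` is a `p`-group, Cor. 3; `I_𝔓 ↠ G_0(𝔮)`,
Serre I §7 Prop. 22 (b)).  [cite: SerreLocalFields1979, Ch. IV §2 Cor. 1 and Cor. 3 of Prop. 7] -/
theorem exists_apply_inertia_eq_apply_torsion_mul_zpow
    {v : HeightOneSpectrum (𝓞 K)} {𝔓 : Ideal (absIntegers (𝓞 K) K)} (h𝔓 : 𝔓 ∈ v.primesAbove)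
    {H : Type*} [Group H] [TopologicalSpace H] [DiscreteTopology H]
    (f : absoluteGaloisGroup K →ₜ* H) :
    ∃ s ∈ 𝔓.inertia (absoluteGaloisGroup K), ∀ g ∈ 𝔓.inertia (absoluteGaloisGroup K),
      ∃ (k : ℤ) (w : absoluteGaloisGroup K), w ∈ 𝔓.inertia (absoluteGaloisGroup K) ∧
        (∃ t : ℕ, f w ^ (ringChar (𝓞 K ⧸ v.asIdeal)) ^ t = 1) ∧ f g = f w * f s ^ k := by
  haveI : 𝔓.IsPrime := h𝔓.1
  haveI : 𝔓.IsMaximal := HeightOneSpectrum.isMaximal_of_mem_primesAbove h𝔓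
  -- `f` factors through a finite Galois `E/K`
  obtain ⟨E, hEfd, hEgal, hker⟩ := exists_isGalois_ker_le K f
  haveI := hEfd
  haveI := hEgal
  haveI : Algebra.IsSeparable K E := Algebra.IsSeparable.of_integral K E
  set res : absoluteGaloisGroup K →* (E ≃ₐ[K] E) := absRestrictNormalHom E with hres
  have hsurj : Function.Surjective res :=
    (AlgEquiv.restrictNormalHom_surjective (F := K) (K₁ := E) (AlgebraicClosure K)).comp
      (absoluteGaloisGroup.toAlgEquiv K).surjective
  set fbar : (E ≃ₐ[K] E) →* H := MonoidHom.liftOfSurjective res hsurj ⟨f.toMonoidHom, hker⟩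
    with hfbar
  have hfbar_apply : ∀ σ : absoluteGaloisGroup K, fbar (res σ) = f σ := fun σ ↦
    MonoidHom.liftOfRightInverse_comp_apply res _ _ ⟨f.toMonoidHom, hker⟩ σ
  -- the prime `𝔮 = 𝔓 ∩ E` and its inertia group `G_0(𝔮) = I_𝔓|_E`
  set 𝔮 := 𝔓.comap (E.integralClosureToAbsIntegers (𝓞 K)) with h𝔮
  have hinertia : 𝔮.inertia (E ≃ₐ[K] E) = (𝔓.inertia (absoluteGaloisGroup K)).map res :=
    inertia_comap_eq_map_absRestrictNormalHom 𝔓 E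
  -- `G_0(𝔮) = G_1(𝔮) · ⟨s̄⟩`
  haveI : Finite (𝓞 K ⧸ 𝔓.under (𝓞 K)) := by
    rw [← h𝔓.2.over]
    exact Ideal.finiteQuotientOfFreeOfNeBot v.asIdeal v.ne_bot
  have h0 : 𝔓.under (𝓞 K) ≠ ⊥ := by
    rw [← h𝔓.2.over]
    exact v.ne_bot
  obtain ⟨sbar, hsbar, hgen⟩ :=
    GaloisRep.exists_inertia_comap_eq_ramificationSubgroup_one_mul_zpowers (𝓞 K) 𝔓 h0 E
  -- `G_1(𝔮)` is a `p`-group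
  have hG1 : IsPGroup (ringChar (𝓞 K ⧸ v.asIdeal)) (𝔮.ramificationSubgroup (E ≃ₐ[K] E) 1) :=
    isPGroup_ramificationSubgroup_one_of_mem_primesAbove h𝔓 E
  -- lift `s̄` to `s ∈ I_𝔓`
  have hsbar' : sbar ∈ (𝔓.inertia (absoluteGaloisGroup K)).map res := hinertia ▸ hsbar
  obtain ⟨s, hs, hres_s⟩ := hsbar'
  refine ⟨s, hs, fun g hg ↦ ?_⟩
  have hgbar : res g ∈ 𝔮.inertia (E ≃ₐ[K] E) := hinertia ▸ ⟨g, hg, rfl⟩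
  obtain ⟨k, hk⟩ := hgen (res g) hgbar
  -- `w := g · (s^k)⁻¹ ∈ I_𝔓` restricts into `G_1(𝔮)`
  refine ⟨k, g * (s ^ k)⁻¹, (𝔓.inertia _).mul_mem hg ((𝔓.inertia _).inv_mem ((𝔓.inertia _).zpow_mem hs k)),
    ?_, by rw [map_mul, map_inv, map_zpow, inv_mul_cancel_right]⟩
  have hw : res (g * (s ^ k)⁻¹) ∈ 𝔮.ramificationSubgroup (E ≃ₐ[K] E) 1 := by
    rw [map_mul, map_inv, map_zpow, hres_s]
    exact hk
  obtain ⟨t, ht⟩ := hG1 ⟨_, hw⟩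
  refine ⟨t, ?_⟩
  have ht' : (res (g * (s ^ k)⁻¹)) ^ (ringChar (𝓞 K ⧸ v.asIdeal)) ^ t = 1 := by
    have := congrArg Subtype.val ht
    simpa using this
  rw [← hfbar_apply, ← map_pow, ht', map_one]

end Tame

/-! ## §2 Abhyankar's lemma at level `2` for the Selmer condition -/

section General

variable {F : Type} [Field F] [NumberField F] (W : WeierstrassCurve F) [W.IsElliptic]
variable (L : Type) [Field L] [NumberField L] [Algebra F L]
variable (v : HeightOneSpectrum (𝓞 F)) (w : HeightOneSpectrum (𝓞 L)) [w.asIdeal.LiesOver v.asIdeal]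

/-- **Every class of `H¹(F, E[2])` becomes Selmer upstairs at a ramified good odd place.**  Let `E = W/F` be elliptic with good
reduction at `v ∤ 2`, `w ∣ v` a place of `L`, `𝔔` a prime of `\bar ℤ_L` above `w`, `𝔓 = 𝔔 ∩ \bar ℤ_F`, and suppose `L/F` is
"ramified of even index at `𝔓`" in the following witnessed sense: there is a continuous homomorphism `χ : Γ_F → C` to a discrete
group with `χ² = 1`, trivial on `res Γ_L`, and non-trivial on the inertia group `I_𝔓` (for `L = F(√c)`: the Kummer character of
`c`, non-trivial on inertia when `ord_v(c)` is odd).  Then for EVERY `x ∈ H¹(F, E[2])` the restriction `res x ∈ H¹(L, E_L[2])`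
satisfies the Selmer (= unramified, Gross (7.1)/(7.4)) condition at `w`.  Proof: a cocycle `φ` of `x` is a homomorphism on `I_𝔓`
killed by `2` (inertia acts trivially on `E[2]`, AEC VII.4.1); by §1 applied to `(φ ⋊ ρ, χ)` there is `s ∈ I_𝔓` with
`(φ g, χ g) = (φ s, χ s)^k · (wild of odd order) = (k·φ s, χ(s)^k)` on `I_𝔓`; `χ(s) ≠ 1` (else `χ(I_𝔓) = 1`), and for
`g = res τ`, `τ ∈ I_𝔔`, `χ(s)^k = χ(g) = 1` forces `k` even, so `φ(g) = k·φ(s) = 0`.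
[cite: SerreLocalFields1979, Ch. IV §2 Cor. 1 and Cor. 3 of Prop. 7] [cite: GrossLMS1991, §7 (7.1) and (7.4)]
[cite: NeukirchANT1999, Ch. II (7.13)] -/
theorem resTorsion_two_mem_selmerLocalKer_of_ramifiedCharacter
    (hgood : W.HasGoodReductionAt v) (h2 : ((2 : ℤ) : 𝓞 F) ∉ v.asIdeal)
    {𝔔 : Ideal (absIntegers (𝓞 L) L)} (h𝔔 : 𝔔 ∈ w.primesAbove)
    {C : Type} [CommGroup C] [TopologicalSpace C] [DiscreteTopology C]
    (χ : absoluteGaloisGroup F →ₜ* C) (hχ2 : ∀ g, χ g ^ 2 = 1)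
    (hχL : ∀ τ : absoluteGaloisGroup L, χ (absGaloisRestrict F L τ) = 1)
    (hχram : ∃ σ₀ ∈ (𝔔.comap (absIntegersMap F L)).inertia (absoluteGaloisGroup F), χ σ₀ ≠ 1)
    (x : galH1Torsion W 2) :
    resTorsion W L 2 x ∈ selmerLocalKer (W.baseChange L) (w.adicCompletion L) 2 := by
  set 𝔓 := 𝔔.comap (absIntegersMap F L) with h𝔓def
  have hwv : w.asIdeal.under (𝓞 F) = v.asIdeal :=
    (Ideal.LiesOver.over (P := w.asIdeal) (p := v.asIdeal)).symm
  have h𝔓 : 𝔓 ∈ v.primesAbove := comap_absIntegersMap_mem_primesAbove hwv h𝔔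
  have hgoodL : (W.baseChange L).HasGoodReductionAt w :=
    hasGoodReductionAt_baseChange_of_hasGoodReductionAt W L v w hgood
  have hnL : ((2 : ℤ) : 𝓞 L) ∉ w.asIdeal := intCast_notMem_of_liesOver L v w h2
  -- the upstairs Selmer condition is "unramified at `𝔔`"
  rw [(W.baseChange L).selmerLocalKer_eq_unramifiedKer hgoodL hnL h𝔔]
  obtain ⟨φ, rfl⟩ :=
    oneCocycleClass_surjective (discreteTopRep (absoluteGaloisGroup F) (geomTorsion W 2)) x
  rw [resTorsion, resH1Hom_oneCocycleClass, unramifiedKer, oneCocycleClass_mem_subgroupResKer_iff]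
  -- inertia acts trivially on `E[2]` downstairs
  have hI : ∀ σ ∈ 𝔓.inertia (absoluteGaloisGroup F), ∀ P : geomTorsion W 2, σ • P = P :=
    fun σ hσ P ↦ W.smul_geomTorsion_eq_of_mem_inertia hgood h2 h𝔓 hσ P
  -- values in `E[2]` are `2`-torsion
  have h2tor : ∀ P : geomTorsion W 2, P + P = 0 := fun P ↦ by
    rw [← two_zsmul]
    exact Subtype.ext (by simp)
  -- MAIN: `φ g = 0` for every `g ∈ I_𝔓` with `χ g = 1`
  suffices hmain : ∀ g ∈ 𝔓.inertia (absoluteGaloisGroup F), χ g = 1 → φ.1 g = 0 by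
    refine ⟨0, fun τ ↦ ?_⟩
    obtain ⟨t0, ht0⟩ := τ
    rw [smul_zero, sub_zero, pullback_resHomOfEquivariant_apply]
    change torsionBaseChangeMap W L 2 (φ.1 (absGaloisRestrict F L t0)) = 0
    have ht0' : absGaloisRestrict F L t0 ∈ 𝔓.inertia (absoluteGaloisGroup F) := by
      have hmem : t0 ∈ (𝔓.inertia (absoluteGaloisGroup F)).comap (absGaloisRestrict F L).toMonoidHom := by
        rw [comap_inertia_comap_absIntegersMap F L 𝔔]; exact ht0
      exact Subgroup.mem_comap.mp hmem
    rw [hmain _ ht0' (hχL t0), map_zero]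
  /- the holomorph-valued homomorphism `g ↦ (φ g, ρ g)` -/
  haveI : Finite (geomTorsion W 2) := finite_geomTorsion W two_ne_zero
  -- continuity of the orbit maps on `E[2]`
  have hcont_smul : ∀ m : geomTorsion W 2, Continuous fun g : absoluteGaloisGroup F => g • m := fun m ↦
    continuous_induced_rng.2 (by
      change Continuous fun g : absoluteGaloisGroup F => ((g • m : geomTorsion W 2) : W.geomPoints)
      simp only [AddSubgroup.torsionBy.coe_smul]
      exact W.continuous_smul_geomPoints (m : W.geomPoints))
  let N := Multiplicative (geomTorsion W 2)
  let αfun : absoluteGaloisGroup F → MulAut N := fun g =>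
    { toFun := fun n => Multiplicative.ofAdd (g • Multiplicative.toAdd n)
      invFun := fun n => Multiplicative.ofAdd (g⁻¹ • Multiplicative.toAdd n)
      left_inv := fun n => by simp [smul_smul]
      right_inv := fun n => by simp [smul_smul]
      map_mul' := fun a b => by rw [toAdd_mul, smul_add, ofAdd_add] }
  have hαfun : ∀ g (n : N), αfun g n = Multiplicative.ofAdd (g • Multiplicative.toAdd n) := fun _ _ ↦ rfl
  let α : absoluteGaloisGroup F →* MulAut N :=
    { toFun := αfun
      map_one' := MulEquiv.ext fun n => by rw [hαfun, one_smul, ofAdd_toAdd, MulAut.one_apply]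
      map_mul' := fun g h => MulEquiv.ext fun n => by
        rw [hαfun, MulAut.mul_apply, hαfun, hαfun, toAdd_ofAdd, mul_smul] }
  have hα : ∀ g (n : N), α g n = Multiplicative.ofAdd (g • Multiplicative.toAdd n) := fun _ _ ↦ rfl
  let S := N ⋊[MonoidHom.id (MulAut N)] MulAut N
  let fhom : absoluteGaloisGroup F →* S :=
    { toFun := fun g => ⟨Multiplicative.ofAdd (φ.1 g), α g⟩
      map_one' := by
        refine SemidirectProduct.ext ?_ ?_
        · change Multiplicative.ofAdd (φ.1 1) = 1
          rw [contOneCocycles.apply_one, ofAdd_zero]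
        · change α 1 = 1
          exact map_one α
      map_mul' := fun g h => by
        refine SemidirectProduct.ext ?_ ?_
        · rw [SemidirectProduct.mul_left, MonoidHom.id_apply]
          change Multiplicative.ofAdd (φ.1 (g * h)) = Multiplicative.ofAdd (φ.1 g) * α g (Multiplicative.ofAdd (φ.1 h))
          rw [hα, toAdd_ofAdd, ← ofAdd_add, φ.2 g h, discreteTopRep_ρ_apply]
        · rw [SemidirectProduct.mul_right]
          exact map_mul α g h }
  letI : TopologicalSpace S := ⊥
  haveI : DiscreteTopology S := ⟨rfl⟩
  letI : TopologicalSpace (MulAut N) := ⊥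
  haveI : DiscreteTopology (MulAut N) := ⟨rfl⟩
  -- continuity of `α` (fibres cut out by the finitely many orbit maps) and of `fhom`
  have hαcont : Continuous α := by
    rw [continuous_discrete_rng]
    intro e
    have hset : (α : absoluteGaloisGroup F → MulAut N) ⁻¹' {e} =
        (fun g : absoluteGaloisGroup F => fun m : geomTorsion W 2 => g • m) ⁻¹'
          {fun m => Multiplicative.toAdd (e (Multiplicative.ofAdd m))} := by
      ext g
      simp only [Set.mem_preimage, Set.mem_singleton_iff]
      constructor
      · intro h
        funext m
        rw [← h, hα, toAdd_ofAdd, toAdd_ofAdd]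
      · intro h
        refine MulEquiv.ext fun n => ?_
        have := congrFun h (Multiplicative.toAdd n)
        rw [ofAdd_toAdd] at this
        rw [hα, this, ofAdd_toAdd]
    rw [hset]
    exact (continuous_pi fun m => hcont_smul m).isOpen_preimage _ (isOpen_discrete _)
  have hfcont : Continuous fhom := by
    have h1 : Continuous fun g : absoluteGaloisGroup F => (φ.1 g, α g) := φ.1.continuous.prodMk hαcont
    have h2' : Continuous fun q : geomTorsion W 2 × MulAut N => (⟨Multiplicative.ofAdd q.1, q.2⟩ : S) :=
      continuous_of_discreteTopology
    exact h2'.comp h1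
  let f : absoluteGaloisGroup F →ₜ* S := ⟨fhom, hfcont⟩
  have hf_apply : ∀ g, f g = ⟨Multiplicative.ofAdd (φ.1 g), α g⟩ := fun _ ↦ rfl
  -- on inertia `ρ = 1`, so `(f g)² = 1`
  have hα_inertia : ∀ g ∈ 𝔓.inertia (absoluteGaloisGroup F), α g = 1 := by
    intro g hg
    refine MulEquiv.ext fun n => ?_
    rw [hα, hI g hg, ofAdd_toAdd, MulAut.one_apply]
  have hf_sq : ∀ g ∈ 𝔓.inertia (absoluteGaloisGroup F), f g ^ 2 = 1 := by
    intro g hg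
    rw [pow_two, hf_apply]
    refine SemidirectProduct.ext ?_ ?_
    · rw [SemidirectProduct.mul_left, SemidirectProduct.one_left, hα_inertia g hg, MonoidHom.id_apply,
        MulAut.one_apply, ← ofAdd_add, h2tor, ofAdd_zero]
    · rw [SemidirectProduct.mul_right, SemidirectProduct.one_right, hα_inertia g hg, mul_one]
  -- §1 for the pair `(f, χ)`
  have hprod : ∀ g, (f.prod χ) g = (f g, χ g) := fun _ ↦ rfl
  obtain ⟨s, hs, hgen⟩ := exists_apply_inertia_eq_apply_torsion_mul_zpow (K := F) h𝔓 (f.prod χ)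
  -- the residue characteristic is an odd prime, so an element killed by `2` and by `p^t` is trivial
  have hp : Nat.Prime (ringChar (𝓞 F ⧸ v.asIdeal)) := by
    letI : Field (𝓞 F ⧸ v.asIdeal) := Ideal.Quotient.field v.asIdeal
    haveI : Finite (𝓞 F ⧸ v.asIdeal) := Ideal.finiteQuotientOfFreeOfNeBot v.asIdeal v.ne_bot
    exact CharP.char_is_prime (𝓞 F ⧸ v.asIdeal) (ringChar (𝓞 F ⧸ v.asIdeal))
  have hp2 : ringChar (𝓞 F ⧸ v.asIdeal) ≠ 2 := by
    intro h
    apply h2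
    rw [← Ideal.Quotient.eq_zero_iff_mem, map_intCast]
    have hc : ((ringChar (𝓞 F ⧸ v.asIdeal) : ℕ) : 𝓞 F ⧸ v.asIdeal) = 0 := ringChar.Nat.cast_ringChar
    rw [h] at hc
    exact_mod_cast hc
  have hkill : ∀ (y : S × C) (t : ℕ), y ^ 2 = 1 → y ^ (ringChar (𝓞 F ⧸ v.asIdeal)) ^ t = 1 → y = 1 := by
    intro y t hy2 hyt
    have hcop : Nat.Coprime 2 ((ringChar (𝓞 F ⧸ v.asIdeal)) ^ t) :=
      ((Nat.coprime_primes Nat.prime_two hp).mpr (Ne.symm hp2)).pow_right t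
    have h1 : orderOf y ∣ 2 := orderOf_dvd_of_pow_eq_one hy2
    have h2' : orderOf y ∣ (ringChar (𝓞 F ⧸ v.asIdeal)) ^ t := orderOf_dvd_of_pow_eq_one hyt
    have h3 : orderOf y ∣ Nat.gcd 2 ((ringChar (𝓞 F ⧸ v.asIdeal)) ^ t) := Nat.dvd_gcd h1 h2'
    rw [hcop, Nat.dvd_one] at h3
    exact orderOf_eq_one_iff.mp h3
  -- on `I_𝔓` the pair `(f, χ)` is a power of `(f s, χ s)` (the wild factor is trivial)
  have hpow : ∀ g ∈ 𝔓.inertia (absoluteGaloisGroup F), ∃ k : ℤ, f g = f s ^ k ∧ χ g = χ s ^ k := by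
    intro g hg
    obtain ⟨k, w', hw', ⟨t, ht⟩, hgw⟩ := hgen g hg
    have hw1 : (f.prod χ) w' = 1 := by
      refine hkill _ t ?_ ht
      rw [hprod]
      exact Prod.ext (by simpa using hf_sq w' hw') (by simpa using hχ2 w')
    rw [hw1, one_mul, hprod, hprod] at hgw
    exact ⟨k, by simpa using congrArg Prod.fst hgw, by simpa using congrArg Prod.snd hgw⟩
  -- `χ s` has order exactly `2`
  obtain ⟨σ₀, hσ₀, hχσ₀⟩ := hχram
  have hχs : χ s ≠ 1 := by
    intro h1
    obtain ⟨k, -, hk⟩ := hpow σ₀ hσ₀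
    rw [h1, one_zpow] at hk
    exact hχσ₀ hk
  have hord : orderOf (χ s) = 2 := orderOf_eq_prime (hχ2 s) hχs
  -- conclusion: `χ g = 1` forces an even exponent, and `(f s)² = 1`
  intro g hg hχg
  obtain ⟨k, hfk, hχk⟩ := hpow g hg
  have hdvd : (2 : ℤ) ∣ k := by
    have hk1 : χ s ^ k = 1 := hχk.symm.trans hχg
    have := orderOf_dvd_iff_zpow_eq_one.mpr hk1
    rw [hord] at this
    exact_mod_cast this
  obtain ⟨j, rfl⟩ := hdvd
  have hfg : f g = 1 := by
    rw [hfk, zpow_mul, zpow_ofNat, hf_sq s hs, one_zpow]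
  rw [hf_apply] at hfg
  have hleft := congrArg SemidirectProduct.left hfg
  rw [SemidirectProduct.one_left] at hleft
  change Multiplicative.ofAdd (φ.1 g) = 1 at hleft
  exact Multiplicative.ofAdd.injective (hleft.trans ofAdd_zero.symm)

end General


end Summit.BirchSwinnertonDyer.BirchSwinnertonDyer.Theorems.GenusExact.SelmerDescent

end
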